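import Summits.AtomisticToContinuum.FouriersLaw.Theorems.PhononMeanFreePathIncoherentChannelLightCone
import Summits.AtomisticToContinuum.FouriersLaw.Theorems.PhononMeanFreePathIncoherentChannelVarianceTransportHelper1
import Summits.AtomisticToContinuum.FouriersLaw.Theorems.PhononMeanFreePathIncoherentBoundedCorrelationDecay
import Summits.AtomisticToContinuum.FouriersLaw.Theorems.PhononMeanFreePathIncoherentChannelChannelBookkeeping

/-!
# Stubs `lightConePiece_of_powerCovLightCone` and `incoherentChannel_iff_postCone_of_powerCovLightCone`
# of line `two-horizons-forecast-loss` (crux `PhononMeanFreePath.IncoherentChannel`)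

Registered stubs of the lead's skeleton of crux stmt-AtomisticToContinuum-11811
(`Summit.AtomisticToContinuum.FouriersLaw.Theses.PhononMeanFreePath.IncoherentChannel`), proved with exactly
the registered signatures. Write `C_N(t) = powerCov … N t = Cov_{μ₀}(p_0², K_t p_N²)` and
`r_N(t) = pairCorr … N t` for the `(N+1)`-site pinned anharmonic chain with both baths at `T`.
Both stubs ASSUME the four-point light cone `hC` (`|C_N(t)| ≤ ε_N` for `0 ≤ t ≤ N^η`, `N^{1+η} ε_N → 0`,
the lead's stub `powerCov_lightCone`) and fix `η ∈ (0,1)`.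

* `lightConePiece_of_powerCovLightCone` — the causal window of the FULL crux integrand carries nothing:
  `N(γ²/T²) ∫_{(0,N^η]} (C_N − 2 r_N²) → 0`. Proof: on the window `|C_N| ≤ ε_N` (hypothesis) and
  `r_N² ≤ ε'_N` (the landed `stub_lightCone`), so the integral over a set of measure `N^η` is at most
  `(ε_N + 2ε'_N) N^η` (`norm_setIntegral_le_of_norm_le_const`, no integrability needed), and
  `N · N^η = N^{1+η}`.
* `incoherentChannel_iff_postCone_of_powerCovLightCone` — POST-CONE NORMAL FORM of the crux:
  `IncoherentChannel ↔ ∀ params > 0, ∃ κ > 0, N(γ²/T²) ∫_{(N^η,∞)} (C_N − 2 r_N²) → κ`. Proof: at fixed `N`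
  the integrand is integrable on `(0,∞)` (`powerCov_integrableOn`, `IncoherentBounded.rN_sq_integrableOn`),
  so `∫_{(0,∞)} = ∫_{(0,N^η]} + ∫_{(N^η,∞)}`; the first piece times `N(γ²/T²)` tends to `0` by the first
  stub, and the crux's printed sequence is the vocabulary one (`cruxSeq_eq_printed`).

No definition, no `sorry`, standard axioms.
-/

noncomputable section

namespace Summit.AtomisticToContinuum.FouriersLaw.Theorems.PhononMeanFreePath

open MeasureTheory Set Filter Topology
open scoped NNReal
open Literature.MathematicalPhysics.KineticTheory.HeatConduction
open Summit.AtomisticToContinuum.FouriersLaw.Theses.PhononMeanFreePath (IncoherentChannel)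
open Summit.AtomisticToContinuum.FouriersLaw.Theorems.IncoherentBounded (rN_sq_integrableOn)

/-- **Registered stub (c9) `lightConePiece_of_powerCovLightCone`** — D5 piece 1: given the four-point light
cone, the causal window of the FULL crux integrand carries nothing, `N(γ²/T²)∫_{(0,N^η]}(C_N − 2r_N²) → 0` for
every `η ∈ (0,1)` (with the landed `stub_lightCone` for `r_N²`; the window has measure `N^η` and the integrand
is bounded there by `ε_N + 2ε'_N`, no integrability needed). [folklore] -/
theorem lightConePiece_of_powerCovLightCone
    (hC : ∀ ω₂ lam β γ : ℝ, 0 < ω₂ → 0 < lam → 0 < β → 0 < γ → ∀ T : ℝ, 0 < T → ∀ η : ℝ, 0 < η → η < 1 →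
      ∃ ε : ℕ → ℝ, Tendsto (fun N : ℕ => (N : ℝ) ^ (1 + η) * ε N) atTop (𝓝 0) ∧
        ∀ (N : ℕ) (t : ℝ), 0 ≤ t → t ≤ (N : ℝ) ^ η → |powerCov ω₂ lam β γ T N t| ≤ ε N)
    {η : ℝ} (hη : 0 < η) (hη1 : η < 1) :
    ∀ ω₂ lam β γ : ℝ, 0 < ω₂ → 0 < lam → 0 < β → 0 < γ → ∀ T : ℝ, 0 < T →
      Tendsto (fun N : ℕ => (N : ℝ) * (γ ^ 2 / T ^ 2) *
        ∫ t in Ioc (0 : ℝ) ((N : ℝ) ^ η), (powerCov ω₂ lam β γ T N t - 2 * (pairCorr ω₂ lam β γ T N t) ^ 2))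
        atTop (𝓝 0) := by
  intro ω₂ lam β γ hω hl hβ hγ T hT
  obtain ⟨ε, hε, hCε⟩ := hC ω₂ lam β γ hω hl hβ hγ T hT η hη hη1
  obtain ⟨ε', hε', hPε⟩ := stub_lightCone ω₂ lam β γ hω hl hβ hγ T hT η hη hη1
  -- the bound `‖N(γ²/T²)∫_{(0,N^η]}(C_N − 2r_N²)‖ ≤ (γ²/T²)(N^{1+η}ε_N + 2 N^{1+η}ε'_N)` at every `N`
  have hbound : ∀ N : ℕ, ‖(N : ℝ) * (γ ^ 2 / T ^ 2) *
      ∫ t in Ioc (0 : ℝ) ((N : ℝ) ^ η), (powerCov ω₂ lam β γ T N t - 2 * (pairCorr ω₂ lam β γ T N t) ^ 2)‖ ≤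
      (γ ^ 2 / T ^ 2) * ((N : ℝ) ^ (1 + η) * ε N + 2 * ((N : ℝ) ^ (1 + η) * ε' N)) := by
    intro N
    have hN0 : (0 : ℝ) ≤ N := Nat.cast_nonneg N
    have hNη : (0 : ℝ) ≤ (N : ℝ) ^ η := Real.rpow_nonneg hN0 η
    have h1 : ‖∫ t in Ioc (0 : ℝ) ((N : ℝ) ^ η),
        (powerCov ω₂ lam β γ T N t - 2 * (pairCorr ω₂ lam β γ T N t) ^ 2)‖ ≤
        (ε N + 2 * ε' N) * volume.real (Ioc (0 : ℝ) ((N : ℝ) ^ η)) := by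
      refine norm_setIntegral_le_of_norm_le_const measure_Ioc_lt_top fun t ht => ?_
      have hC' := hCε N t ht.1.le ht.2
      have hP' := hPε N t ht.1.le ht.2
      have hr2 : (pairCorr ω₂ lam β γ T N t) ^ 2 ≤ ε' N :=
        le_trans (le_add_of_nonneg_left (abs_nonneg _)) hP'
      have hr0 : 0 ≤ (pairCorr ω₂ lam β γ T N t) ^ 2 := sq_nonneg _
      obtain ⟨hC1, hC2⟩ := abs_le.1 hC'
      rw [Real.norm_eq_abs, abs_le]
      constructor <;> linarith
    rw [Real.volume_real_Ioc_of_le hNη, sub_zero] at h1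
    have e : (N : ℝ) ^ (1 + η) = (N : ℝ) * (N : ℝ) ^ η := by
      rw [Real.rpow_add' hN0 (by linarith), Real.rpow_one]
    rw [norm_mul, norm_mul, Real.norm_natCast, Real.norm_of_nonneg (by positivity : (0 : ℝ) ≤ γ ^ 2 / T ^ 2), e]
    calc (N : ℝ) * (γ ^ 2 / T ^ 2) * ‖∫ t in Ioc (0 : ℝ) ((N : ℝ) ^ η),
          (powerCov ω₂ lam β γ T N t - 2 * (pairCorr ω₂ lam β γ T N t) ^ 2)‖ ≤
        (N : ℝ) * (γ ^ 2 / T ^ 2) * ((ε N + 2 * ε' N) * (N : ℝ) ^ η) :=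
          mul_le_mul_of_nonneg_left h1 (by positivity)
      _ = (γ ^ 2 / T ^ 2) * ((N : ℝ) * (N : ℝ) ^ η * ε N + 2 * ((N : ℝ) * (N : ℝ) ^ η * ε' N)) := by ring
  have hlim : Tendsto (fun N : ℕ => (γ ^ 2 / T ^ 2) * ((N : ℝ) ^ (1 + η) * ε N + 2 * ((N : ℝ) ^ (1 + η) * ε' N)))
      atTop (𝓝 0) := by
    have h := (hε.add (hε'.const_mul 2)).const_mul (γ ^ 2 / T ^ 2)
    simpa using h
  exact squeeze_zero_norm hbound hlim

/-- Fixed-`N` splitting of the crux sequence at the light-cone time `N^η`: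
`N(γ²/T²)∫_{(0,∞)}(C_N − 2r_N²) = N(γ²/T²)∫_{(0,N^η]}(…) + N(γ²/T²)∫_{(N^η,∞)}(…)`, by the fixed-`N`
integrability of `C_N` and `r_N²` on `(0,∞)`. [folklore] -/
theorem postCone_cruxSeq_split {ω₂ lam β γ T : ℝ} (hω : 0 < ω₂) (hl : 0 < lam) (hβ : 0 < β) (hγ : 0 < γ)
    (hT : 0 < T) (η : ℝ) (N : ℕ) :
    (N : ℝ) * (γ ^ 2 / T ^ 2) *
        (∫ t in Ioi (0 : ℝ), (powerCov ω₂ lam β γ T N t - 2 * (pairCorr ω₂ lam β γ T N t) ^ 2)) =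
      (N : ℝ) * (γ ^ 2 / T ^ 2) *
          (∫ t in Ioc (0 : ℝ) ((N : ℝ) ^ η), (powerCov ω₂ lam β γ T N t - 2 * (pairCorr ω₂ lam β γ T N t) ^ 2)) +
        (N : ℝ) * (γ ^ 2 / T ^ 2) *
          (∫ t in Ioi ((N : ℝ) ^ η), (powerCov ω₂ lam β γ T N t - 2 * (pairCorr ω₂ lam β γ T N t) ^ 2)) := by
  have hNη : (0 : ℝ) ≤ (N : ℝ) ^ η := Real.rpow_nonneg (Nat.cast_nonneg N) η
  have hr : IntegrableOn (fun t => (pairCorr ω₂ lam β γ T N t) ^ 2) (Ioi (0 : ℝ)) :=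
    rN_sq_integrableOn hω hl.le hβ hγ hT N
  have hf : IntegrableOn (fun t => powerCov ω₂ lam β γ T N t - 2 * (pairCorr ω₂ lam β γ T N t) ^ 2)
      (Ioi (0 : ℝ)) :=
    (powerCov_integrableOn ω₂ lam β γ hω hl hβ hγ T hT N).sub (hr.const_mul 2)
  rw [← mul_add, ← setIntegral_union (Ioc_disjoint_Ioi le_rfl) measurableSet_Ioi
    (hf.mono_set Ioc_subset_Ioi_self) (hf.mono_set (Ioi_subset_Ioi hNη)), Ioc_union_Ioi_eq_Ioi hNη]

/-- Given the four-point light cone, at every parameter point and every `κ`, the crux sequence tends to `κ`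
iff its post-cone part does: the causal window contributes `→ 0` (`lightConePiece_of_powerCovLightCone`).
[folklore] -/
theorem postCone_tendsto_iff
    (hC : ∀ ω₂ lam β γ : ℝ, 0 < ω₂ → 0 < lam → 0 < β → 0 < γ → ∀ T : ℝ, 0 < T → ∀ η : ℝ, 0 < η → η < 1 →
      ∃ ε : ℕ → ℝ, Tendsto (fun N : ℕ => (N : ℝ) ^ (1 + η) * ε N) atTop (𝓝 0) ∧
        ∀ (N : ℕ) (t : ℝ), 0 ≤ t → t ≤ (N : ℝ) ^ η → |powerCov ω₂ lam β γ T N t| ≤ ε N)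
    {η : ℝ} (hη : 0 < η) (hη1 : η < 1) {ω₂ lam β γ T : ℝ} (hω : 0 < ω₂) (hl : 0 < lam) (hβ : 0 < β)
    (hγ : 0 < γ) (hT : 0 < T) (κ : ℝ) :
    Tendsto (fun N : ℕ => (N : ℝ) * (γ ^ 2 / T ^ 2) *
        ∫ t in Ioi (0 : ℝ), (powerCov ω₂ lam β γ T N t - 2 * (pairCorr ω₂ lam β γ T N t) ^ 2)) atTop (𝓝 κ) ↔
      Tendsto (fun N : ℕ => (N : ℝ) * (γ ^ 2 / T ^ 2) *
        ∫ t in Ioi ((N : ℝ) ^ η), (powerCov ω₂ lam β γ T N t - 2 * (pairCorr ω₂ lam β γ T N t) ^ 2))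
        atTop (𝓝 κ) := by
  have h0 := lightConePiece_of_powerCovLightCone hC hη hη1 ω₂ lam β γ hω hl hβ hγ T hT
  constructor
  · intro h
    have h' := h.sub h0
    rw [sub_zero] at h'
    refine h'.congr fun N => ?_
    rw [postCone_cruxSeq_split hω hl hβ hγ hT η N]
    ring
  · intro h
    have h' := h0.add h
    rw [zero_add] at h'
    exact h'.congr fun N => (postCone_cruxSeq_split hω hl hβ hγ hT η N).symm

/-- **Registered stub (c9) `incoherentChannel_iff_postCone_of_powerCovLightCone`** — POST-CONE NORMAL FORM OF
THE CRUX: given the four-point light cone, for every `η ∈ (0,1)`,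
`IncoherentChannel ↔ ∀ params > 0, ∃ κ > 0, N(γ²/T²)∫_{(N^η,∞)}(C_N − 2r_N²) → κ` (fixed-`N` integrability of
both terms: `powerCov_integrableOn`, `IncoherentBounded.rN_sq_integrableOn`; the causal window carries nothing:
`lightConePiece_of_powerCovLightCone`). [folklore] -/
theorem incoherentChannel_iff_postCone_of_powerCovLightCone
    (hC : ∀ ω₂ lam β γ : ℝ, 0 < ω₂ → 0 < lam → 0 < β → 0 < γ → ∀ T : ℝ, 0 < T → ∀ η : ℝ, 0 < η → η < 1 →
      ∃ ε : ℕ → ℝ, Tendsto (fun N : ℕ => (N : ℝ) ^ (1 + η) * ε N) atTop (𝓝 0) ∧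
        ∀ (N : ℕ) (t : ℝ), 0 ≤ t → t ≤ (N : ℝ) ^ η → |powerCov ω₂ lam β γ T N t| ≤ ε N)
    {η : ℝ} (hη : 0 < η) (hη1 : η < 1) :
    IncoherentChannel ↔
      ∀ ω₂ lam β γ : ℝ, 0 < ω₂ → 0 < lam → 0 < β → 0 < γ → ∀ T : ℝ, 0 < T →
        ∃ κ : ℝ, 0 < κ ∧ Tendsto (fun N : ℕ => (N : ℝ) * (γ ^ 2 / T ^ 2) *
          ∫ t in Ioi ((N : ℝ) ^ η), (powerCov ω₂ lam β γ T N t - 2 * (pairCorr ω₂ lam β γ T N t) ^ 2))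
          atTop (𝓝 κ) := by
  constructor
  · intro h ω₂ lam β γ hω hl hβ hγ T hT
    obtain ⟨κ, hκ, hlim⟩ := h ω₂ lam β γ hω hl hβ hγ T hT
    refine ⟨κ, hκ, (postCone_tendsto_iff hC hη hη1 hω hl hβ hγ hT κ).1 ?_⟩
    exact hlim.congr' (Eventually.of_forall fun N =>
      (cruxSeq_eq_printed (ω₂ := ω₂) (lam := lam) (β := β) (γ := γ) (T := T) N).symm)
  · intro h ω₂ lam β γ hω hl hβ hγ T hT
    obtain ⟨κ, hκ, hlim⟩ := h ω₂ lam β γ hω hl hβ hγ T hT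
    refine ⟨κ, hκ, ?_⟩
    have h' := (postCone_tendsto_iff hC hη hη1 hω hl hβ hγ hT κ).2 hlim
    exact h'.congr' (Eventually.of_forall fun N =>
      cruxSeq_eq_printed (ω₂ := ω₂) (lam := lam) (β := β) (γ := γ) (T := T) N)

end Summit.AtomisticToContinuum.FouriersLaw.Theorems.PhononMeanFreePath

end
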